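import Summits.SmoothPoincare4.SmoothPoincare4.Theses.ConvexBisection
import Literature.AlgebraicTopology.SingularHomology.ExcisionMayerVietoris
import Literature.Topology.FourManifolds.HomotopyS4CompactProofs
import HarnessLib

/-!
# Crux `ConvexBisection.AcyclicBisectionRigidity` is EXACTLY the conjunction of its three route sectors
# (item stmt-SmoothPoincare4-10507, route route-SmoothPoincare4-ConvexBisection; line lead c8)

Sorry-free bookkeeping file (`--supports stmt-SmoothPoincare4-10507`).  The route files the crux
`AcyclicBisectionRigidity` (rank 2, item 10507) AND, since the route-choice repair of 2026-08-16, its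
three sectors as separate cruxes: the planar sector `PlanarAcyclicBisectionRigidity` (item 15086), the
contractible sector `ContractibleTwistedDoubleStandard` (item 3546, stated for every compact `X`, not
only for homotopy spheres) and the residual sector `ResidualAcyclicBisectionRigidity` (item 14769); the
PROVED support `AcyclicRigidityBySectorsPA` (item 15087) is the implication sectors ⇒ crux.  This file
records the converse and hence the EQUIVALENCE

  `AcyclicBisectionRigidity ↔ PlanarAcyclicBisectionRigidity ∧ ContractibleSector ∧ ResidualAcyclicBisectionRigidity`,

where `ContractibleSector` — written inline, the tree has no definition for it outside the disprover's
workfile (`Cruxes/AcyclicBisectionRigidity/Disproof.lean` §4) — is item 3546 RESTRICTED to homotopy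
4-spheres `M ≃ₕ S⁴` (the only instances the route's deciding theorem ever feeds it), and the one-line
`contractibleSector_of_contractibleTwistedDoubleStandard` (item 3546 ⇒ its restriction; a homotopy
4-sphere is compact by the PROVED `compactSpace_of_homotopyEquiv_sphere_four_holds`).

Use (for the planner): item 10507 carries no content beyond items 15086 ∧ 3546 ∧ 14769 — every proof or
refutation of it is a proof or refutation of one of them, and conversely closing the three closes it
(`AcyclicRigidityBySectorsPA_holds`).  Together with the line's reduction file
(`Theorems/ConvexBisectionAcyclicBisectionRigidityReduction.lean`, p117673: modulo item 0377 the crux is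
the double sector ∧ the GSC lever) this is the formal half of the lead seats' standing recommendation to
retire the separate line chain on 10507 in favour of the three staffed sector cruxes.

Everything here is pure logic over the route definitions; no definitions, no named facts, no `sorry`.
-/

noncomputable section

-- The namespace is prescribed by the crux protocol (`Summit.<P>.<Sub>.Theorems.<Crux>` with
-- `P = Sub = SmoothPoincare4`), hence the duplicated component.
set_option linter.dupNamespace false

open scoped Manifold ContDiff Topology ContinuousMap
open Set Function
open Literature.Geometry.Symplectic Literature.AlgebraicTopology.SingularHomology CategoryTheory.Limits
open Literature.Topology.FourManifolds

namespace Summit.SmoothPoincare4.SmoothPoincare4.Theorems.AcyclicBisectionRigidity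

open Summit.SmoothPoincare4.SmoothPoincare4.Theses.ConvexBisection

/-- **Item 3546 implies its restriction to homotopy 4-spheres (the contractible sector of crux 2).**
`ContractibleTwistedDoubleStandard` speaks about every compact Hausdorff second-countable smooth `X`
bisected into two contractible Stein halves along a common contact seam; a homotopy 4-sphere `M ≃ₕ S⁴` is
compact (`compactSpace_of_homotopyEquiv_sphere_four_holds`, Hatcher Prop. 3.29), so the item applies to
it verbatim.  (Re-derivation, as an importable Theorems lemma, of the disprover's
`Disproof.contractibleSector_of_crux4`.) [folklore] -/
theorem helper_contractibleSector_of_contractibleTwistedDoubleStandard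
    (h4 : ContractibleTwistedDoubleStandard) :
    ∀ (M : Type) [TopologicalSpace M] [T2Space M] [SecondCountableTopology M]
      [ChartedSpace (EuclideanSpace ℝ (Fin 4)) M] [IsManifold (𝓡 4) ∞ M],
      M ≃ₕ Metric.sphere (0 : EuclideanSpace ℝ (Fin 5)) 1 →
      (∃ (W₁ : Type) (_ : TopologicalSpace W₁) (_ : ChartedSpace (EuclideanHalfSpace 4) W₁)
        (_ : IsManifold (𝓡∂ 4) ∞ W₁) (_ : CompactSpace W₁) (_ : ContractibleSpace W₁)
        (W₂ : Type) (_ : TopologicalSpace W₂) (_ : ChartedSpace (EuclideanHalfSpace 4) W₂)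
        (_ : IsManifold (𝓡∂ 4) ∞ W₂) (_ : CompactSpace W₂) (_ : ContractibleSpace W₂)
        (J₁ : SteinStructure W₁) (J₂ : SteinStructure W₂) (e₁ : W₁ → M) (e₂ : W₂ → M),
        Manifold.IsSmoothEmbedding (𝓡∂ 4) (𝓡 4) ∞ e₁ ∧ Manifold.IsSmoothEmbedding (𝓡∂ 4) (𝓡 4) ∞ e₂ ∧
        Set.range e₁ ∪ Set.range e₂ = Set.univ ∧
        Set.range e₁ ∩ Set.range e₂ = e₁ '' (𝓡∂ 4).boundary W₁ ∧
        Set.range e₁ ∩ Set.range e₂ = e₂ '' (𝓡∂ 4).boundary W₂ ∧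
        (∀ w₁ w₂, e₁ w₁ = e₂ w₂ →
          Submodule.map (mfderiv (𝓡∂ 4) (𝓡 4) e₁ w₁).toLinearMap (contactPlane J₁.J w₁) =
          Submodule.map (mfderiv (𝓡∂ 4) (𝓡 4) e₂ w₂).toLinearMap (contactPlane J₂.J w₂))) →
      Nonempty (M ≃ₘ⟮𝓡 4, 𝓡 4⟯ Metric.sphere (0 : EuclideanSpace ℝ (Fin 5)) 1) := by
  intro M _ _ _ _ _ e hb
  obtain ⟨W₁, _, _, _, _, _, W₂, _, _, _, _, _, J₁, J₂, e₁, e₂, h₁, h₂, hc, hs₁, hs₂, hξ⟩ := hb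
  haveI : CompactSpace M := compactSpace_of_homotopyEquiv_sphere_four_holds M e
  exact h4 M W₁ W₂ J₁ J₂ e₁ e₂ h₁ h₂ hc hs₁ hs₂ hξ

/-- **Crux 2 is EXACTLY the conjunction of its three route sectors.**
`AcyclicBisectionRigidity ↔ PlanarAcyclicBisectionRigidity ∧ ContractibleSector ∧ ResidualAcyclicBisectionRigidity`,
with `ContractibleSector` = item 3546 restricted to homotopy 4-spheres, written inline.  `→`: the planar
and residual sectors are the crux with extra hypotheses appended, and contractible halves are ℚ-acyclic in
positive degrees (`isZero_singularHomology_of_contractibleSpace`: homotopy invariance of singular homology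
and the point).  `←`: case analysis on planarity of the `J₁`-induced boundary contact structure and on
contractibility of the two halves, repacking the witness each time — the script of the PROVED support
`AcyclicRigidityBySectorsPA` (item 15087, p87624 lineage) with the contractible case fed the SAME `M`.
Pure logic; no named facts. [folklore] -/
theorem helper_crux_iff_routeSectors :
    AcyclicBisectionRigidity ↔
      (PlanarAcyclicBisectionRigidity ∧
      (∀ (M : Type) [TopologicalSpace M] [T2Space M] [SecondCountableTopology M]
        [ChartedSpace (EuclideanSpace ℝ (Fin 4)) M] [IsManifold (𝓡 4) ∞ M],
        M ≃ₕ Metric.sphere (0 : EuclideanSpace ℝ (Fin 5)) 1 →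
        (∃ (W₁ : Type) (_ : TopologicalSpace W₁) (_ : ChartedSpace (EuclideanHalfSpace 4) W₁)
          (_ : IsManifold (𝓡∂ 4) ∞ W₁) (_ : CompactSpace W₁) (_ : ContractibleSpace W₁)
          (W₂ : Type) (_ : TopologicalSpace W₂) (_ : ChartedSpace (EuclideanHalfSpace 4) W₂)
          (_ : IsManifold (𝓡∂ 4) ∞ W₂) (_ : CompactSpace W₂) (_ : ContractibleSpace W₂)
          (J₁ : SteinStructure W₁) (J₂ : SteinStructure W₂) (e₁ : W₁ → M) (e₂ : W₂ → M),
          Manifold.IsSmoothEmbedding (𝓡∂ 4) (𝓡 4) ∞ e₁ ∧ Manifold.IsSmoothEmbedding (𝓡∂ 4) (𝓡 4) ∞ e₂ ∧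
          Set.range e₁ ∪ Set.range e₂ = Set.univ ∧
          Set.range e₁ ∩ Set.range e₂ = e₁ '' (𝓡∂ 4).boundary W₁ ∧
          Set.range e₁ ∩ Set.range e₂ = e₂ '' (𝓡∂ 4).boundary W₂ ∧
          (∀ w₁ w₂, e₁ w₁ = e₂ w₂ →
            Submodule.map (mfderiv (𝓡∂ 4) (𝓡 4) e₁ w₁).toLinearMap (contactPlane J₁.J w₁) =
            Submodule.map (mfderiv (𝓡∂ 4) (𝓡 4) e₂ w₂).toLinearMap (contactPlane J₂.J w₂))) →
        Nonempty (M ≃ₘ⟮𝓡 4, 𝓡 4⟯ Metric.sphere (0 : EuclideanSpace ℝ (Fin 5)) 1)) ∧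
      ResidualAcyclicBisectionRigidity) := by
  constructor
  · intro h
    refine ⟨?_, ?_, ?_⟩
    · -- planar sector: drop the planarity conjunct
      intro M _ _ _ _ _ e hb
      obtain ⟨W₁, _, _, _, _, W₂, _, _, _, _, J₁, J₂, e₁, e₂, h₁, h₂, hcov, hs₁, hs₂, hξ, hacyc, _hp⟩ := hb
      exact h M e ⟨W₁, _, _, _, _, W₂, _, _, _, _, J₁, J₂, e₁, e₂, h₁, h₂, hcov, hs₁, hs₂, hξ, hacyc⟩
    · -- contractible sector: contractible halves are ℚ-acyclic in positive degrees
      intro M _ _ _ _ _ e hb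
      obtain ⟨W₁, _, _, _, _, _, W₂, _, _, _, _, _, J₁, J₂, e₁, e₂, h₁, h₂, hcov, hs₁, hs₂, hξ⟩ := hb
      exact h M e ⟨W₁, _, _, _, _, W₂, _, _, _, _, J₁, J₂, e₁, e₂, h₁, h₂, hcov, hs₁, hs₂, hξ,
        fun k hk => ⟨isZero_singularHomology_of_contractibleSpace ℚ ℚ (X := W₁) hk.ne',
          isZero_singularHomology_of_contractibleSpace ℚ ℚ (X := W₂) hk.ne'⟩⟩
    · -- residual sector: drop the two negated conjuncts
      intro M _ _ _ _ _ e hb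
      obtain ⟨W₁, _, _, _, _, W₂, _, _, _, _, J₁, J₂, e₁, e₂, h₁, h₂, hcov, hs₁, hs₂, hξ, hacyc, _hnp, _hnc⟩ := hb
      exact h M e ⟨W₁, _, _, _, _, W₂, _, _, _, _, J₁, J₂, e₁, e₂, h₁, h₂, hcov, hs₁, hs₂, hξ, hacyc⟩
  · rintro ⟨hP, hC, hS⟩ M _ _ _ _ _ e hb
    obtain ⟨W₁, _, _, _, _, W₂, _, _, _, _, J₁, J₂, e₁, e₂, h₁, h₂, hcov, hs₁, hs₂, hξ, hacyc⟩ := hb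
    by_cases hp : PlanarContactBoundary J₁
    · exact hP M e
        ⟨W₁, _, _, _, _, W₂, _, _, _, _, J₁, J₂, e₁, e₂, h₁, h₂, hcov, hs₁, hs₂, hξ, hacyc, hp⟩
    by_cases hc : ContractibleSpace W₁ ∧ ContractibleSpace W₂
    · obtain ⟨hc₁, hc₂⟩ := hc
      exact hC M e ⟨W₁, _, _, _, _, hc₁, W₂, _, _, _, _, hc₂, J₁, J₂, e₁, e₂, h₁, h₂, hcov, hs₁, hs₂, hξ⟩
    · exact hS M e
        ⟨W₁, _, _, _, _, W₂, _, _, _, _, J₁, J₂, e₁, e₂, h₁, h₂, hcov, hs₁, hs₂, hξ, hacyc, hp, hc⟩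

end Summit.SmoothPoincare4.SmoothPoincare4.Theorems.AcyclicBisectionRigidity

end
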